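import Summits.SmoothPoincare4.SmoothPoincare4.Theorems.RootDecompAEDoublesShadowTwoRoeBlocks

/-!
# Grade-two dichotomy for KMN encoding graphs (Roe certificates), part 10/17: exponent sums of the relators; rows and used letters

§6 Substitution and exponent lemmas for port words and gluing relators (`lift_gluingRelator`,
`expo_inl_gluingRelator`); §7a the exponent table `tab`, the used letters `cols R` and the rows `rows R L` of a
peeling state.

THE FAMILY (16 modules `Theorems/RootDecompAEDoublesShadowTwoRoe*.lean` + the closing module
`Theorems/RootDecompAEDoublesShadowTwoStubGradeTwoDichotomy.lean`, one namespace
`Summit.SmoothPoincare4.SmoothPoincare4.Theorems.RootDecompAEDoublesShadowTwoStubGradeTwoDichotomy`, chained imports,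
split by topic to respect the 400-line bound on proof files; the local-table parts import only `…RoeDefs`).
-/

open Function
open Literature.Topology.FourManifolds

set_option linter.dupNamespace false

noncomputable section

namespace Summit.SmoothPoincare4.SmoothPoincare4.Theorems.RootDecompAEDoublesShadowTwoStubGradeTwoDichotomy

/-! ## §6 Exponent sums and substitutions in the relators of `P(G₂)` -/

section GraphAlgebra

variable {ι : Type} [DecidableEq ι]

/-- Exponent sums are transported along an injective renaming of the letters. -/
theorem expo_map_injective₂ {κ : Type} [DecidableEq κ] (f : ι → κ) (hf : Function.Injective f) (i : ι)
    (w₂ : FreeGroup ι) : expo i w₂ = expo (f i) (FreeGroup.map f w₂) := by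
  symm
  have h : (gexp (f i)).comp (FreeGroup.map f) = gexp i := by
    refine FreeGroup.ext_hom _ _ fun i' => ?_
    simp only [MonoidHom.coe_comp, Function.comp_apply, FreeGroup.map.of, gexp, FreeGroup.lift_apply_of]
    by_cases hii : i' = i
    · simp [hii]
    · simp [hii, hf.ne hii]
  unfold expo
  exact congrArg Multiplicative.toAdd (DFunLike.congr_fun h w₂)

omit [DecidableEq ι] in
/-- A letter outside the image of a renaming has exponent sum zero in every renamed word. -/
theorem expo_map_eq_zero₂ {κ : Type} [DecidableEq κ] (f : ι → κ) (w₂ : FreeGroup ι) (j : κ)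
    (hj : ∀ i, f i ≠ j) : expo j (FreeGroup.map f w₂) = 0 := by
  have h : (gexp j).comp (FreeGroup.map f) = 1 := by
    refine FreeGroup.ext_hom _ _ fun i' => ?_
    simp [gexp, hj i']
  unfold expo
  have := DFunLike.congr_fun h w₂
  simp only [MonoidHom.coe_comp, Function.comp_apply, MonoidHom.one_apply] at this
  rw [this]
  rfl

omit [DecidableEq ι] in
/-- Substitution after renaming is substitution of the composite. -/
theorem lift_map_eq₂ {κ H : Type} [Group H] (F : κ → H) (f : ι → κ) (w₂ : FreeGroup ι) :
    FreeGroup.lift (F ∘ f) w₂ = FreeGroup.lift F (FreeGroup.map f w₂) := by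
  symm
  have h : (FreeGroup.lift F).comp (FreeGroup.map f) = FreeGroup.lift (F ∘ f) :=
    FreeGroup.ext_hom _ _ fun i => by simp
  exact DFunLike.congr_fun h w₂

omit [DecidableEq ι] in
/-- A homomorphism applied after a substitution is the substitution of the composite. -/
theorem hom_lift_eq₂ {H H' : Type} [Group H] [Group H'] (φ : H →* H') (f : ι → H) (w₂ : FreeGroup ι) :
    FreeGroup.lift (φ ∘ f) w₂ = φ (FreeGroup.lift f w₂) := by
  symm
  have h : φ.comp (FreeGroup.lift f) = FreeGroup.lift (φ ∘ f) := FreeGroup.ext_hom _ _ fun i => by simp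
  exact DFunLike.congr_fun h w₂

omit [DecidableEq ι] in
/-- Substituting `1` for every letter kills the word. -/
theorem lift_const_one₂ {H : Type} [Group H] (w₂ : FreeGroup ι) :
    (1 : H) = FreeGroup.lift (fun _ : ι => (1 : H)) w₂ := by
  symm
  have h : FreeGroup.lift (fun _ : ι => (1 : H)) = 1 := FreeGroup.ext_hom _ _ fun i => by simp
  rw [h]
  rfl

omit [DecidableEq ι] in
/-- Homomorphisms commute with the optional inversion `sgnw`. -/
theorem hom_sgnw₂ {κ : Type} (t : Bool) (f : FreeGroup ι →* FreeGroup κ) (w₂ : FreeGroup ι) :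
    f (sgnw t w₂) = sgnw t (f w₂) := by
  cases t <;> simp [sgnw]

end GraphAlgebra


namespace ShadowGraph

variable (G₂ : ShadowGraph)

/-- The letters of piece `v`. -/
def ltr (v : Fin G₂.k) : Fin 3 → G₂.Gen := fun i => Sum.inl (v, i)

/-- The spine letters of one piece are distinct. -/
theorem ltr_injective₂ (v : Fin G₂.k) : Function.Injective (G₂.ltr v) := by
  intro i j h
  simpa [ltr] using h

/-- `embed v` is the renaming `i ↦ x_(v, i)`. -/
theorem embed_apply (v : Fin G₂.k) (w : FreeGroup (Fin 3)) : G₂.embed v w = FreeGroup.map (G₂.ltr v) w := rfl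

/-- Substitution into a port word placed at piece `v` is substitution of the `v`-letters into the port word. -/
theorem lift_portWordAt₂ {H : Type} [Group H] (F : G₂.Gen → H) (p : Fin G₂.k × ℕ) :
    FreeGroup.lift F (G₂.portWordAt p) = FreeGroup.lift (F ∘ G₂.ltr p.1) ((G₂.piece p.1).portWord p.2) := by
  unfold ShadowGraph.portWordAt
  rw [embed_apply, ← lift_map_eq₂]

/-- Exponent sum of a spine letter `x_(v, i)` in a port word placed at a piece: zero away from `v`. -/
theorem expo_inl_portWordAt (v : Fin G₂.k) (i : Fin 3) (p : Fin G₂.k × ℕ) :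
    expo (Sum.inl (v, i)) (G₂.portWordAt p) = if p.1 = v then expo i ((G₂.piece p.1).portWord p.2) else 0 := by
  unfold ShadowGraph.portWordAt
  rw [embed_apply]
  split_ifs with h
  · have : (Sum.inl (v, i) : G₂.Gen) = G₂.ltr p.1 i := by simp [ltr, h]
    rw [this, ← expo_map_injective₂ _ (G₂.ltr_injective₂ _)]
  · exact expo_map_eq_zero₂ _ _ _ (fun i' => by simp [ltr, h])

/-- The orientation sign of the `e`-th gluing as an integer. -/
def osgn (e : Fin G₂.m) : ℤ := if G₂.sgn e then 1 else -1

/-- The orientation sign `±1` is a unit. -/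
theorem isUnit_osgn₂ (e : Fin G₂.m) : IsUnit (G₂.osgn e) := by
  unfold osgn; split_ifs <;> simp

/-- THE EXPONENT TABLE ENTRY of a spine letter in a gluing relator: source port word plus signed target port word. -/
theorem expo_inl_gluingRelator (v : Fin G₂.k) (i : Fin 3) (e : Fin G₂.m) :
    expo (Sum.inl (v, i)) (G₂.gluingRelator e) =
      expo (Sum.inl (v, i)) (G₂.portWordAt (G₂.src e)) + G₂.osgn e * expo (Sum.inl (v, i)) (G₂.portWordAt (G₂.tgt e)) := by
  unfold ShadowGraph.gluingRelator ShadowGraph.stable osgn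
  cases G₂.sgn e <;> simp

/-- EVALUATION of a substitution on a gluing relator. -/
theorem lift_gluingRelator {β : Type} (F : G₂.Gen → FreeGroup β) (e : Fin G₂.m) :
    FreeGroup.lift F (G₂.gluingRelator e) =
      FreeGroup.lift (F ∘ G₂.ltr (G₂.src e).1) ((G₂.piece (G₂.src e).1).portWord (G₂.src e).2) * F (Sum.inr e) *
        sgnw (!G₂.sgn e) (FreeGroup.lift (F ∘ G₂.ltr (G₂.tgt e).1) ((G₂.piece (G₂.tgt e).1).portWord (G₂.tgt e).2)) *
          (F (Sum.inr e))⁻¹ := by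
  unfold ShadowGraph.gluingRelator ShadowGraph.stable
  cases G₂.sgn e <;> simp [sgnw, lift_portWordAt₂]

/-- Two substitutions that agree on the letters of the two end pieces and on the stable letter of a gluing agree on
its relator. -/
theorem lift_gluingRelator_congr {β : Type} (F F' : G₂.Gen → FreeGroup β) (e : Fin G₂.m)
    (hs : ∀ i, F (Sum.inl ((G₂.src e).1, i)) = F' (Sum.inl ((G₂.src e).1, i)))
    (ht : ∀ i, F (Sum.inl ((G₂.tgt e).1, i)) = F' (Sum.inl ((G₂.tgt e).1, i)))
    (he : F (Sum.inr e) = F' (Sum.inr e)) :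
    FreeGroup.lift F (G₂.gluingRelator e) = FreeGroup.lift F' (G₂.gluingRelator e) := by
  rw [lift_gluingRelator, lift_gluingRelator, he]
  have h1 : F ∘ G₂.ltr (G₂.src e).1 = F' ∘ G₂.ltr (G₂.src e).1 := funext fun i => hs i
  have h2 : F ∘ G₂.ltr (G₂.tgt e).1 = F' ∘ G₂.ltr (G₂.tgt e).1 := funext fun i => ht i
  rw [h1, h2]

end ShadowGraph

/-! ## §7 Rows, columns and the exponent table of `P(G₂)`; the geometry of a gluing at a piece -/

namespace ShadowGraph

variable (G₂ : ShadowGraph)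

/-- THE TABLE: exponent sum of the letter `g` in the `e`-th gluing relator. -/
def tab (e : Fin G₂.m) (g : G₂.Gen) : ℤ := expo g (G₂.gluingRelator e)

/-- The USED letters `x_(v, i)`, `i < rank (piece v)`, of the pieces `v ∈ R`. -/
def cols (R : Finset (Fin G₂.k)) : Finset G₂.Gen :=
  ((R ×ˢ (Finset.univ : Finset (Fin 3))).filter fun p => (p.2 : ℕ) < (G₂.piece p.1).rank).map
    ⟨Sum.inl, Sum.inl_injective⟩

/-- Membership in the used letters of `R`. -/
theorem mem_cols_iff₂ (R : Finset (Fin G₂.k)) (g : G₂.Gen) :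
    g ∈ G₂.cols R ↔ ∃ v i, g = Sum.inl (v, i) ∧ v ∈ R ∧ (i : ℕ) < (G₂.piece v).rank := by
  constructor
  · intro h
    simp only [cols, Finset.mem_map, Finset.mem_filter, Finset.mem_product, Finset.mem_univ, and_true,
      Function.Embedding.coeFn_mk] at h
    obtain ⟨⟨v, i⟩, ⟨hv, hi⟩, rfl⟩ := h
    exact ⟨v, i, rfl, hv, hi⟩
  · rintro ⟨v, i, rfl, hv, hi⟩
    simp only [cols, Finset.mem_map, Finset.mem_filter, Finset.mem_product, Finset.mem_univ, and_true,
      Function.Embedding.coeFn_mk]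
    exact ⟨(v, i), ⟨hv, hi⟩, rfl⟩

/-- A spine letter `x_(v, i)` is a used letter of `R` iff `v ∈ R` and `i < rank (piece v)`. -/
theorem inl_mem_cols (R : Finset (Fin G₂.k)) (v : Fin G₂.k) (i : Fin 3) :
    (Sum.inl (v, i) : G₂.Gen) ∈ G₂.cols R ↔ v ∈ R ∧ (i : ℕ) < (G₂.piece v).rank := by
  rw [mem_cols_iff₂]
  constructor
  · rintro ⟨v', i', h, hv, hi⟩
    simp only [Sum.inl.injEq, Prod.mk.injEq] at h
    obtain ⟨rfl, rfl⟩ := h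
    exact ⟨hv, hi⟩
  · rintro ⟨hv, hi⟩
    exact ⟨v, i, rfl, hv, hi⟩

/-- Stable letters are never used spine letters. -/
theorem inr_not_mem_cols₂ (R : Finset (Fin G₂.k)) (e : Fin G₂.m) : (Sum.inr e : G₂.Gen) ∉ G₂.cols R := by
  rw [mem_cols_iff₂]
  rintro ⟨v, i, h, -⟩
  cases h

/-- The used letters are monotone in `R`. -/
theorem cols_mono₂ {R R' : Finset (Fin G₂.k)} (h : R ⊆ R') : G₂.cols R ⊆ G₂.cols R' := by
  intro g hg
  rw [mem_cols_iff₂] at hg ⊢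
  obtain ⟨v, i, rfl, hv, hi⟩ := hg
  exact ⟨v, i, rfl, h hv, hi⟩

/-- No pieces, no used letters. -/
theorem cols_empty₂ : G₂.cols ∅ = ∅ := by
  ext g; simp [mem_cols_iff₂]

/-- The used letters of `R` split into those of `u ∈ R` and those of `R ∖ u`. -/
theorem cols_eq_union₂ (R : Finset (Fin G₂.k)) (u : Fin G₂.k) (hu : u ∈ R) :
    G₂.cols R = G₂.cols {u} ∪ G₂.cols (R.erase u) := by
  ext g
  rw [Finset.mem_union, mem_cols_iff₂, mem_cols_iff₂, mem_cols_iff₂]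
  constructor
  · rintro ⟨v, i, rfl, hv, hi⟩
    by_cases hvu : v = u
    · exact Or.inl ⟨v, i, rfl, by simp [hvu], hi⟩
    · exact Or.inr ⟨v, i, rfl, Finset.mem_erase.mpr ⟨hvu, hv⟩, hi⟩
  · rintro (⟨v, i, rfl, hv, hi⟩ | ⟨v, i, rfl, hv, hi⟩)
    · rw [Finset.mem_singleton] at hv
      exact ⟨v, i, rfl, hv ▸ hu, hi⟩
    · exact ⟨v, i, rfl, Finset.mem_of_mem_erase hv, hi⟩

/-- The used letters of `u` and of `R ∖ u` are disjoint. -/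
theorem cols_disjoint₂ (R : Finset (Fin G₂.k)) (u : Fin G₂.k) : Disjoint (G₂.cols {u}) (G₂.cols (R.erase u)) := by
  rw [Finset.disjoint_left]
  intro g h1 h2
  rw [mem_cols_iff₂] at h1 h2
  obtain ⟨v, i, rfl, hv, -⟩ := h1
  obtain ⟨v', i', h, hv', -⟩ := h2
  simp only [Sum.inl.injEq, Prod.mk.injEq] at h
  obtain ⟨rfl, rfl⟩ := h
  rw [Finset.mem_singleton] at hv
  exact (Finset.mem_erase.mp hv').1 hv

/-- No letter of `u` is a used letter of `R ∖ u`. -/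
theorem inl_not_mem_cols_erase (R : Finset (Fin G₂.k)) (u : Fin G₂.k) (i : Fin 3) :
    (Sum.inl (u, i) : G₂.Gen) ∉ G₂.cols (R.erase u) := by
  rw [inl_mem_cols]
  simp

/-- Every piece has rank at most three. -/
theorem rank_le_three (p : Piece) : p.rank ≤ 3 := by
  cases p <;> simp [Piece.rank]

/-- The piece `u` has `rank (piece u)` used letters. -/
theorem cols_singleton_card₂ (u : Fin G₂.k) : (G₂.cols {u}).card = (G₂.piece u).rank := by
  have key : G₂.cols {u} =
      (Finset.univ.filter fun i : Fin 3 => (i : ℕ) < (G₂.piece u).rank).image fun i => (Sum.inl (u, i) : G₂.Gen) := by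
    ext g
    rw [mem_cols_iff₂, Finset.mem_image]
    constructor
    · rintro ⟨v, i, rfl, hv, hi⟩
      rw [Finset.mem_singleton] at hv
      subst hv
      exact ⟨i, by simp [hi], rfl⟩
    · rintro ⟨i, hi, rfl⟩
      exact ⟨u, i, rfl, Finset.mem_singleton_self u, by simpa using hi⟩
  rw [key, Finset.card_image_of_injective _ (fun i j h => by simpa using h)]
  have h2 := rank_le_three (G₂.piece u)
  generalize (G₂.piece u).rank = r at h2 ⊢
  interval_cases r <;> decide

/-- The ROWS of a peeling state: gluings with both end pieces in `R ∪ L` and at least one in `R`. -/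
def rows (R L : Finset (Fin G₂.k)) : Finset (Fin G₂.m) :=
  Finset.univ.filter fun e =>
    ((G₂.src e).1 ∈ R ∧ ((G₂.tgt e).1 ∈ R ∨ (G₂.tgt e).1 ∈ L)) ∨ ((G₂.tgt e).1 ∈ R ∧ ((G₂.src e).1 ∈ R ∨ (G₂.src e).1 ∈ L))

/-- Membership in the rows of a peeling state. -/
theorem mem_rows₂ (R L : Finset (Fin G₂.k)) (e : Fin G₂.m) :
    e ∈ G₂.rows R L ↔ ((G₂.src e).1 ∈ R ∧ ((G₂.tgt e).1 ∈ R ∨ (G₂.tgt e).1 ∈ L)) ∨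
      ((G₂.tgt e).1 ∈ R ∧ ((G₂.src e).1 ∈ R ∨ (G₂.src e).1 ∈ L)) := by
  simp [rows]

/-- No pieces to peel, no rows. -/
theorem rows_empty₂ (L : Finset (Fin G₂.k)) : G₂.rows ∅ L = ∅ := by
  ext e; simp [mem_rows₂]

end ShadowGraph

end Summit.SmoothPoincare4.SmoothPoincare4.Theorems.RootDecompAEDoublesShadowTwoStubGradeTwoDichotomy
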